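import Summits.QuantumFields.YangMills.Theorems.FluctuationComparisonRegPrIntLS2BetaWhitneyHatLiftRelativeSup
import HarnessLib

/-!
# S2β · THE SUP CHAIN, (β-3)′'s OSC-LIFT LETTER, LIFT HALF (architect ruling 19:55:50Z (i): «`OSC_R(X) ≤ C·(… + lifted coarse oscillation)` — an oscillation-level
# LIFT letter, same shape as the comb row (px12 note)»): THE HAT LIFT DOES NOT INCREASE OSCILLATION AND GAINS `L⁻¹` — for ANY two fine bonds, the lifted logs (absolute)
# and the lifted log-DIFFERENCES (relative) differ by at most `L⁻¹ ×` the oscillation of the coarse data over the two hat supports (convex combinations)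

Cell `ym3-torus` (YM ladder rung R3 = continuum `SU(2)` Yang–Mills on the three-torus at fixed lattice data — a RUNG: NOT d = 4, NOT infinite volume, NOT a mass gap,
NOT Clay).  Width seat «width 12» `ym3-torus-px12` (gen 26), FREE px helper on crux `stmt-QuantumFields-20520`; `--kind proof --supports stmt-QuantumFields-20520 --as
helper`, count-neutral, DEFINITION-FREE (0 `def`, 0 `instance`, 0 `notation`, 0 `sorry`, default heartbeats).

WHY.  The order-2 brick in oscillation form (β-3)′ (px13 g27) prices `q·M_R·OSC_R(X)` with `OSC_R(X)` the oscillation of the relative field over a read region; its per-level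
propagation needs «oscillation of the LIFT over a fine region ≤ L⁻¹ × oscillation of the coarse field over the parent region» (the stage field adds the discrepancy `ε`, an
intra-block ladder — px5∕px20∕✓p833387).  The hat lift is a CONVEX COMBINATION bond by bond (`Σ_e w b e = 1`, `w ≥ 0`, ✓`…WhitneyHatWeights`), of the coarse logs scaled
by `L⁻¹`; two convex combinations of points differ by at most the diameter of the point set.  No adjacency, no direction bookkeeping: ANY two fine bonds.

WHAT IS PROVED (sorry-free).
§1 lattice-free: ★`norm_convexComb_sub_convexComb_le` — weights `p, q ≥ 0` with `Σp = Σq = 1` on finite types, `‖x i − y j‖ ≤ δ` whenever `p i ≠ 0 ≠ q j` ⟹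
   `‖Σ p i • x i − Σ q j • y j‖ ≤ δ` (`Σ_iΣ_j p_i q_j (x_i − y_j)`).
§2 the hat lift (generic `Params`, levels `t`∕`t+1`, weights `hw`, lifts `hV`∕`hV′` by the displayed formula):
   ★★`norm_logVec_lift_sub_logVec_lift_le_osc` (ABSOLUTE: `‖log V b − log V b′‖ ≤ L⁻¹·δ` if `‖log X e − log X e′‖ ≤ δ` across the two supports),
   ★★★`norm_liftRel_sub_liftRel_le_osc` (RELATIVE: `‖(log V b − log V′ b) − (log V b′ − log V′ b′)‖ ≤ L⁻¹·δ` if `‖(log X e − log X′ e) − (log X e′ − log X′ e′)‖ ≤ δ` across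
   the two supports) — the OSC-LIFT letter's lift half, comb-row shape (sup over feeders, constant ONE, gain `L⁻¹`).

HONEST SCOPE.  Convexity bookkeeping over landed lift identities (✓`logVec_lift`, ✓`liftExponent_sub`, ✓`sum_hatW_eq_one`, ✓`hatW_nonneg`); nothing of Bałaban's
renormalisation-group analysis is asserted or proved ([Balaban1985RegularSpaces] (1.29) p.81 — the printed `L⁻¹` regularity of `Q*`-type lifts); (β-3)′ itself, `OSC_R`'s
definition and the stage half (discrepancy ladder), the c₁ rows, (RSP-Σ)'s use, (ST″), LOC, GAP♯∘ (`stub_uniformFibreGapOrbit`, registry 3732b7df UNTOUCHED), the five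
registered stubs (0∕5), S2β, 20520, 19936, 19200, `YM3TorusSU2` are NOT proved; no registered stub is closed; rung R3 — NOT d = 4, NOT infinite volume, NOT a mass gap,
NOT Clay; the Yang–Mills mass gap is NOT proved.
-/

set_option autoImplicit false

namespace Summit.QuantumFields.YangMills.Theorems.FluctuationComparisonRegPrIntLS2BetaLiftOscillation

open Finset
open scoped Real
open Literature.MathematicalPhysics.QuantumLattice (su2Quat)
open Literature.MathematicalPhysics.QuantumFieldTheory.Balaban1983to89
open T4Continuum
open B10Eq27TorusAxialLog (rel)
open T4CubeChartGnomonic (SU2)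
open T4HaarSU2ExpChart (expPoint)
open T4ExpWindowSmallField (logVec)
open Summit.QuantumFields.YangMills.Theorems.FluctuationComparisonRegPrIntLS2BetaWhitneyHatWeights (hatW_nonneg sum_hatW_eq_one)
open Summit.QuantumFields.YangMills.Theorems.FluctuationComparisonRegPrIntLS2BetaWhitneyHatLiftRelative (logVec_lift liftExponent_sub)

/-! ## §1 Two convex combinations differ by at most the diameter -/

/-- ★ **TWO CONVEX COMBINATIONS DIFFER BY AT MOST THE DIAMETER**: `p, q ≥ 0`, `Σp = Σq = 1`, `‖x i − y j‖ ≤ δ` on the supports ⟹ `‖Σ p i • x i − Σ q j • y j‖ ≤ δ`. [folklore] -/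
theorem norm_convexComb_sub_convexComb_le {ι κ E : Type*} [Fintype ι] [Fintype κ] [NormedAddCommGroup E] [NormedSpace ℝ E]
    (p : ι → ℝ) (q : κ → ℝ) (hp0 : ∀ i, 0 ≤ p i) (hq0 : ∀ j, 0 ≤ q j) (hp1 : ∑ i, p i = 1) (hq1 : ∑ j, q j = 1)
    (x : ι → E) (y : κ → E) {δ : ℝ} (hδ : ∀ i j, p i ≠ 0 → q j ≠ 0 → ‖x i - y j‖ ≤ δ) :
    ‖∑ i, p i • x i - ∑ j, q j • y j‖ ≤ δ := by
  -- `Σ p•x − Σ q•y = Σ_i Σ_j (p i * q j) • (x i − y j)`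
  have e1 : ∑ i, p i • x i = ∑ i, ∑ j, (p i * q j) • x i := by
    refine Finset.sum_congr rfl fun i _ => ?_
    rw [← Finset.sum_smul, ← Finset.mul_sum, hq1, mul_one]
  have e2 : ∑ j, q j • y j = ∑ i, ∑ j, (p i * q j) • y j := by
    rw [Finset.sum_comm]
    refine Finset.sum_congr rfl fun j _ => ?_
    rw [← Finset.sum_smul, ← Finset.sum_mul, hp1, one_mul]
  have e3 : ∑ i, p i • x i - ∑ j, q j • y j = ∑ i, ∑ j, (p i * q j) • (x i - y j) := by
    rw [e1, e2, ← Finset.sum_sub_distrib]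
    refine Finset.sum_congr rfl fun i _ => ?_
    rw [← Finset.sum_sub_distrib]
    refine Finset.sum_congr rfl fun j _ => ?_
    rw [smul_sub]
  rw [e3]
  have hterm : ∀ i j, ‖(p i * q j) • (x i - y j)‖ ≤ p i * q j * δ := by
    intro i j
    rw [norm_smul, Real.norm_eq_abs, abs_of_nonneg (mul_nonneg (hp0 i) (hq0 j))]
    by_cases hpi : p i = 0
    · simp [hpi]
    by_cases hqj : q j = 0
    · simp [hqj]
    exact mul_le_mul_of_nonneg_left (hδ i j hpi hqj) (mul_nonneg (hp0 i) (hq0 j))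
  calc ‖∑ i, ∑ j, (p i * q j) • (x i - y j)‖ ≤ ∑ i, ‖∑ j, (p i * q j) • (x i - y j)‖ := norm_sum_le _ _
    _ ≤ ∑ i, ∑ j, p i * q j * δ := Finset.sum_le_sum fun i _ => (norm_sum_le _ _).trans (Finset.sum_le_sum fun j _ => hterm i j)
    _ = (∑ i, p i) * (∑ j, q j) * δ := by rw [Finset.sum_mul_sum, Finset.sum_mul]; simp_rw [Finset.sum_mul]
    _ = δ := by rw [hp1, hq1, one_mul, one_mul]

/-! ## §2 The hat lift does not increase oscillation and gains `L⁻¹` -/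

section Lift

variable {P : Params} {t : ℕ}

/-- ★★ **OSC-LIFT, ABSOLUTE**: for ANY two fine bonds `b, b′`, if the coarse logs differ by at most `δ` across the two hat supports, the lifted logs differ by at most
`L⁻¹·δ` (each `log V b` is a convex combination of the `L⁻¹·log X e`, ✓`logVec_lift`). [cite: Balaban1985RegularSpaces, (1.29) p.81] -/
theorem norm_logVec_lift_sub_logVec_lift_le_osc (ht : t + 1 ≤ P.m + P.K) (w : PBond P t → PBond P (t + 1) → ℝ)
    (hw : ∀ b e, w b e = if e.dir = b.dir ∧ (b.src b.dir - emb e.src b.dir).val < P.L then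
      ∏ ν ∈ Finset.univ.erase b.dir, max 0 (1 - ((rel (emb e.src) b.src ν).natAbs : ℝ) / P.L) else 0)
    (X : GaugeField P (t + 1) SU2) (V : GaugeField P t SU2)
    (hV : ∀ b, V b = expPoint (∑ e, w b e • ((P.L : ℝ)⁻¹ • logVec (su2Quat (X e)))))
    (b b' : PBond P t) {δ : ℝ}
    (hδ : ∀ e e', w b e ≠ 0 → w b' e' ≠ 0 → ‖logVec (su2Quat (X e)) - logVec (su2Quat (X e'))‖ ≤ δ) :
    ‖logVec (su2Quat (V b)) - logVec (su2Quat (V b'))‖ ≤ (P.L : ℝ)⁻¹ * δ := by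
  rw [logVec_lift ht w hw X V hV b, logVec_lift ht w hw X V hV b']
  have hL0 : 0 ≤ (P.L : ℝ)⁻¹ := inv_nonneg.mpr (Nat.cast_nonneg _)
  refine norm_convexComb_sub_convexComb_le (w b) (w b') (hatW_nonneg w hw b) (hatW_nonneg w hw b') (sum_hatW_eq_one ht w hw b)
    (sum_hatW_eq_one ht w hw b') _ _ fun e e' he he' => ?_
  rw [← smul_sub, norm_smul, Real.norm_eq_abs, abs_of_nonneg hL0]
  exact mul_le_mul_of_nonneg_left (hδ e e' he he') hL0

/-- ★★★ **OSC-LIFT, RELATIVE** (the letter's lift half): for ANY two fine bonds `b, b′`, if the coarse log-DIFFERENCES `log X e − log X′ e` oscillate by at most `δ` across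
the two hat supports, the lifted log-differences oscillate by at most `L⁻¹·δ` (✓`liftExponent_sub`: the lift is linear in the logs). [cite: Balaban1985RegularSpaces, (1.29) p.81] -/
theorem norm_liftRel_sub_liftRel_le_osc (ht : t + 1 ≤ P.m + P.K) (w : PBond P t → PBond P (t + 1) → ℝ)
    (hw : ∀ b e, w b e = if e.dir = b.dir ∧ (b.src b.dir - emb e.src b.dir).val < P.L then
      ∏ ν ∈ Finset.univ.erase b.dir, max 0 (1 - ((rel (emb e.src) b.src ν).natAbs : ℝ) / P.L) else 0)
    (X X' : GaugeField P (t + 1) SU2) (V V' : GaugeField P t SU2)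
    (hV : ∀ b, V b = expPoint (∑ e, w b e • ((P.L : ℝ)⁻¹ • logVec (su2Quat (X e)))))
    (hV' : ∀ b, V' b = expPoint (∑ e, w b e • ((P.L : ℝ)⁻¹ • logVec (su2Quat (X' e)))))
    (b b' : PBond P t) {δ : ℝ}
    (hδ : ∀ e e', w b e ≠ 0 → w b' e' ≠ 0 →
      ‖(logVec (su2Quat (X e)) - logVec (su2Quat (X' e))) - (logVec (su2Quat (X e')) - logVec (su2Quat (X' e')))‖ ≤ δ) :
    ‖(logVec (su2Quat (V b)) - logVec (su2Quat (V' b))) - (logVec (su2Quat (V b')) - logVec (su2Quat (V' b')))‖ ≤ (P.L : ℝ)⁻¹ * δ := by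
  rw [logVec_lift ht w hw X V hV b, logVec_lift ht w hw X' V' hV' b, liftExponent_sub,
    logVec_lift ht w hw X V hV b', logVec_lift ht w hw X' V' hV' b', liftExponent_sub]
  have hL0 : 0 ≤ (P.L : ℝ)⁻¹ := inv_nonneg.mpr (Nat.cast_nonneg _)
  refine norm_convexComb_sub_convexComb_le (w b) (w b') (hatW_nonneg w hw b) (hatW_nonneg w hw b') (sum_hatW_eq_one ht w hw b)
    (sum_hatW_eq_one ht w hw b') _ _ fun e e' he he' => ?_
  rw [← smul_sub, norm_smul, Real.norm_eq_abs, abs_of_nonneg hL0]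
  exact mul_le_mul_of_nonneg_left (hδ e e' he he') hL0

end Lift

end Summit.QuantumFields.YangMills.Theorems.FluctuationComparisonRegPrIntLS2BetaLiftOscillation
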